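import Mathlib
import Summits.NavierStokesRegularity.NavierStokesRegularity.Theorems.TaoLadderRungTwoBreakBlowupRigidityOneDatumScaling
import Summits.NavierStokesRegularity.NavierStokesRegularity.Theorems.TaoLadderRungTwoBreakBlowupRigidityOneRobustBudget
import HarnessLib

/-!
# Normal forms with numbers: K2(1) `TaoLadderRungTwoBreak.BlowupRigidityOne` (stmt-NavierStokesRegularity-20206) and the
  rung leaf `Target`, quantified over LIVE tables, UNIT data and budgets BELOW THE EXPLICIT CEILING only

MODEL lattice ODEs only (Tao 2016 §4 Lemma 4.1 (4.5)–(4.11), Thm. 4.2 statement shape); nothing here is a statement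
about the Navier–Stokes equations; NO item is closed (`--supports stmt-NavierStokesRegularity-20206`). DEF-FREE; `m = 4`.

With `C(ε₀) := 8√2·16·(1+ε₀)^{16}·3 = 384√2 (1+ε₀)^{16}` (the ceiling `8√2 m² (1+ε₀)^{16}(2‖X₀‖+1)` of `robustBudget_le` at
`m = 4`, `‖X₀‖ = 1`):

* `noGlobalCascade_iff_smallBudget_unit` — for `α ∈ E₂(R)` and a UNIT datum `‖X₀‖ = 1`: `NoGlobalCascade ε₀ α X₀` iff some
  budget `0 < κ ≤ C(ε₀)` has no global `(κ,κ)`-pseudo-solution from shell `0`;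
* `target_iff_normalForm` — **the rung leaf, fully normalised**: `Target` iff for every `R ≥ 1` there is `ε_R > 0` such
  that for all `ε₀ ∈ (0,ε_R]`, every LIVE table (`α ∈ E₂(R)`, `fluxConst α ≥ R⁻¹`), every UNIT datum and EVERY budget
  `0 < κ ≤ C(ε₀)`, a global `(κ,κ)`-pseudo-solution from shell `0` EXISTS (`HasGlobal ε₀ α κ κ 0 X₀`) — above the
  ceiling it exists for free (`hasGlobal_of_largeBudget`), below it is the whole content of BP-D-latt;
* `blowupRigidityOne_iff_normalForm` — **K2(1), fully normalised**: the same quantifier block with the implication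
  «(∃ budget `0 < κ ≤ C(ε₀)` without a global pseudo-solution) → a non-trivial (S₁)-surviving admissible DSS wave».

HONEST LABEL: bookkeeping normal forms with explicit constants (what exactly a proof or a refutation of either statement
must address); no stub, crux or summit is proved; rung 0.
-/

noncomputable section

-- the summit and its single sub-problem share the name (CONVENTIONS §1)
set_option linter.dupNamespace false

open Set Filter Topology

namespace Summit.NavierStokesRegularity.NavierStokesRegularity.Theorems

namespace BlowupRigidityOne

open Literature.Analysis.FluidPDE Literature.Analysis.FluidPDE.TaoCascade
open Summit.NavierStokesRegularity.NavierStokesRegularity.Theses.TaoLadderRungTwoBreak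

/-- **Robust blow-up of a unit datum, with the ceiling** (`m = 4`): for `ε₀ > 0`, `α ∈ E₂(R)`, `‖X₀‖ = 1`,
`NoGlobalCascade ε₀ α X₀ ↔ ∃ κ, 0 < κ ∧ κ ≤ 384√2 (1+ε₀)^{16} ∧ ¬ HasGlobal ε₀ α κ κ 0 X₀`.
[cite: Tao2016AveragedNS, §4 Thm. 4.2 (statement shape); cell vocabulary (`NoGlobalCascade`, `HasGlobal`)] -/
theorem noGlobalCascade_iff_smallBudget_unit {ε₀ R : ℝ} (hε : 0 < ε₀)
    {α : Fin 4 → Fin 4 → Fin 4 → ℤ × ℤ × ℤ → ℝ} (hα : InTableClass R α) {X₀ : Fin 4 → ℝ} (hX₀ : ‖X₀‖ = 1) :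
    NoGlobalCascade ε₀ α X₀ ↔
      ∃ κ : ℝ, 0 < κ ∧ κ ≤ 384 * Real.sqrt 2 * (1 + ε₀) ^ (16 : ℝ) ∧ ¬ HasGlobal ε₀ α κ κ 0 X₀ := by
  rw [noGlobalCascade_iff_kappa_le hε hα]
  have hC : 8 * Real.sqrt 2 * ((4 : ℕ) : ℝ) ^ 2 * (1 + ε₀) ^ (16 : ℝ) * (2 * ‖X₀‖ + 1)
      = 384 * Real.sqrt 2 * (1 + ε₀) ^ (16 : ℝ) := by
    rw [hX₀]; push_cast; ring
  rw [hC]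

/-- **THE RUNG LEAF IN NORMAL FORM (live tables, unit data, budgets below the ceiling).** `Target` holds iff for every
`R ≥ 1` there is `ε_R > 0` such that for all `ε₀ ∈ (0, ε_R]`, all `α ∈ E₂(R)` with `R⁻¹ ≤ fluxConst α`, all data with
`‖X₀‖ = 1` and all budgets `0 < κ ≤ 384√2 (1+ε₀)^{16}`, a global `(κ,κ)`-pseudo-solution from shell `0` exists.
[cite: Tao2016AveragedNS, §4 Thm. 4.2 (statement shape), Lemma 4.1 (4.5)–(4.11); cell vocabulary (`Target` = `RungTwoBreakLatt`)] -/
theorem target_iff_normalForm :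
    Target ↔
      ∀ R : ℝ, 1 ≤ R → ∃ εR : ℝ, 0 < εR ∧ ∀ ε₀ : ℝ, 0 < ε₀ → ε₀ ≤ εR →
        ∀ (α : Fin 4 → Fin 4 → Fin 4 → ℤ × ℤ × ℤ → ℝ) (X₀ : Fin 4 → ℝ),
          InTableClass R α → R⁻¹ ≤ fluxConst α → ‖X₀‖ = 1 →
            ∀ κ : ℝ, 0 < κ → κ ≤ 384 * Real.sqrt 2 * (1 + ε₀) ^ (16 : ℝ) → HasGlobal ε₀ α κ κ 0 X₀ := by
  rw [target_iff_unitData]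
  constructor
  · intro h R hR
    obtain ⟨εR, hεR, H⟩ := h R hR
    refine ⟨εR, hεR, fun ε₀ hε hle α X₀ hα _ hX₀ κ hκ hκC => ?_⟩
    by_contra hno
    exact H ε₀ hε hle α X₀ hα hX₀
      ((noGlobalCascade_iff_smallBudget_unit hε hα hX₀).2 ⟨κ, hκ, hκC, hno⟩)
  · intro h R hR
    obtain ⟨εR, hεR, H⟩ := h R hR
    refine ⟨εR, hεR, fun ε₀ hε hle α X₀ hα hX₀ hNG => ?_⟩
    obtain ⟨hflux, -⟩ := live_of_noGlobalCascade hε hα hNG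
    obtain ⟨κ, hκ, hκC, hno⟩ := (noGlobalCascade_iff_smallBudget_unit hε hα hX₀).1 hNG
    exact hno (H ε₀ hε hle α X₀ hα hflux hX₀ κ hκ hκC)

/-- **K2(1) IN NORMAL FORM (live tables, unit data, budgets below the ceiling).** `BlowupRigidityOne` holds iff for every
`R ≥ 1` there is `ε_s > 0` such that for all `ε₀ ∈ (0, ε_s]`, all `α ∈ E₂(R)` with `R⁻¹ ≤ fluxConst α` and all data with
`‖X₀‖ = 1`: if SOME budget `0 < κ ≤ 384√2 (1+ε₀)^{16}` has no global `(κ,κ)`-pseudo-solution from shell `0`, then `α`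
carries a non-trivial (S₁)-surviving admissible DSS wave at ratio `1+ε₀`.
[cite: Tao2016AveragedNS, §4 Thm. 4.2 (statement shape); cell vocabulary (K2(1))] -/
theorem blowupRigidityOne_iff_normalForm :
    BlowupRigidityOne ↔
      ∀ R : ℝ, 1 ≤ R → ∃ εs : ℝ, 0 < εs ∧ ∀ ε₀ : ℝ, 0 < ε₀ → ε₀ ≤ εs →
        ∀ (α : Fin 4 → Fin 4 → Fin 4 → ℤ × ℤ × ℤ → ℝ) (X₀ : Fin 4 → ℝ),
          InTableClass R α → R⁻¹ ≤ fluxConst α → ‖X₀‖ = 1 →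
            (∃ κ : ℝ, 0 < κ ∧ κ ≤ 384 * Real.sqrt 2 * (1 + ε₀) ^ (16 : ℝ) ∧ ¬ HasGlobal ε₀ α κ κ 0 X₀) →
              ∃ (q : ℕ) (π : Equiv.Perm (Fin q)) (T : ℝ) (Φ : Fin q → ℝ → Em 4),
                IsDSSWave ε₀ α π T Φ ∧ Surviving 1 ε₀ T ∧ ∃ r x, Φ r x ≠ 0 := by
  rw [blowupRigidityOne_iff_unitData]
  constructor
  · intro h R hR
    obtain ⟨εs, hεs, H⟩ := h R hR
    refine ⟨εs, hεs, fun ε₀ hε hle α X₀ hα _ hX₀ hκ => ?_⟩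
    exact H ε₀ hε hle α X₀ hα hX₀ ((noGlobalCascade_iff_smallBudget_unit hε hα hX₀).2 hκ)
  · intro h R hR
    obtain ⟨εs, hεs, H⟩ := h R hR
    refine ⟨εs, hεs, fun ε₀ hε hle α X₀ hα hX₀ hNG => ?_⟩
    obtain ⟨hflux, -⟩ := live_of_noGlobalCascade hε hα hNG
    exact H ε₀ hε hle α X₀ hα hflux hX₀ ((noGlobalCascade_iff_smallBudget_unit hε hα hX₀).1 hNG)

end BlowupRigidityOne

end Summit.NavierStokesRegularity.NavierStokesRegularity.Theorems

end
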